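import Summits.KontsevichZagierPeriods.KontsevichZagierPeriods.Theorems.RootDecompRelativeModAbsoluteCircleSplitP05

/-! # `RootDecompRelativeModAbsoluteCircleSplitP06` — part 6/11 of the mechanical ≤400-line split of `csk_min.lean` (sha256 066c56c743abe73e…)
Source: decomp-kz lens-3 g14 CircleSplitK.lean @3d3b9378 (= CircleSplit @d1112051 §0–§25 + §26 kernel split + §27 odd→log; critic CLEARED g6-21 l.1371, g7-2 l.1388) minus the 65 declarations already landed in …CircleLogP1–P11 / …CylLogSplitP46–P49 and minus the 20 superseded g13-glue/tame-class lemmas not on the §26–§27 chain; imports …CylLogSplitP48 + …CircleLogP11; --supports stmt-KontsevichZagierPeriods-30572.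
Split by census-1 g10 `gen/splitlean.py`: scopes re-opened with their `open`/`variable`/`set_option` context; mathematics and declaration order unchanged. -/

noncomputable section
open Set MeasureTheory Filter Topology
open scoped BigOperators
open Literature.NumberTheory.Transcendental Literature.ModelTheory.ExponentialFields
namespace Summit.KontsevichZagierPeriods.RootDecompRelativeModAbsolute.Rung30571.RegularisedLogLayer.CylLog.Leaf
namespace G13
variable {b : ℕ}

/-! ### §7c `CircleBoundaryRigidity → CellCloseCSTame` — THE ASSEMBLY (twin of g11 `cellCloseLS_tame`): D1 split,
open → closed band, per index the move to the band (`eᵢ = 1`: D4±/monomial fold; `eᵢ = 2`: the scaling `t = θ√κᵢ`),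
the θ-constant fold, the coefficient dictionary (`sqTrans_eq`, `sqPoly_eq_circPoly`), and `tameCloseC`. -/

/-- Closed form of the transcendental coefficient: `sqTrans r N κ = (−1)^N T_r(0)/κ^N`. -/
theorem sqTrans_eq (r N : ℕ) (κ : ℝ) :
    sqTrans r N κ = (-1) ^ N * (if r = 0 then (1:ℝ) else 1 / 2) / κ ^ N := by
  induction N with
  | zero => simp [sqTrans]
  | succ N ih =>
    rw [sqTrans, ih, pow_succ, pow_succ, neg_div, div_div]
    ring

/-- **Coefficient dictionary:** the rational part `sqPoly` of the closed form equals the rational part `circPoly` of the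
circle telescope after the scaling `t = θ√κ`: `sqPoly r N κ = circPoly r N (√κ) / √κ^{2N+r+1}`. -/
theorem sqPoly_eq_circPoly (r N : ℕ) {κ : ℝ} (hκ : 0 < κ) :
    sqPoly r N κ = circPoly r N (Real.sqrt κ) / Real.sqrt κ ^ (2 * N + r + 1) := by
  have hu2 : Real.sqrt κ ^ 2 = κ := Real.sq_sqrt hκ.le
  set s := Real.sqrt κ with hs_def
  have hs : 0 < s := Real.sqrt_pos.mpr hκ
  have hκs : κ = s ^ 2 := hu2.symm
  induction N with
  | zero => simp [sqPoly, circPoly]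
  | succ N ih =>
    have hrec : circPoly r (N + 1) s =
        s ^ (2 * N + r + 1) / (((2 * N + r : ℕ) : ℝ) + 1) - circPoly r N s := by
      simp only [circPoly]
      rw [Finset.sum_range_succ, sub_eq_neg_add, ← Finset.sum_neg_distrib]
      congr 1
      · exact Finset.sum_congr rfl fun n _ => by ring
      · have hNN : (-1:ℝ) ^ N * (-1) ^ N = 1 := by rw [← mul_pow]; simp
        rw [pow_succ]
        linear_combination (s ^ (2 * N + r + 1) / (((2 * N + r : ℕ) : ℝ) + 1)) * hNN
    have hA : (((2 * N + r : ℕ) : ℝ) + 1) ≠ 0 := by positivity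
    rw [sqPoly, ih, hrec, show 2 * (N + 1) + r + 1 = (2 * N + r + 1) + 2 by ring, pow_add, hκs]
    field_simp
    ring

/-- No pole on the closed band: `0 < 1 + θ^e κ` for `θ ∈ [0,1]`, `κ > −1`. -/
theorem one_add_pow_mul_pos {θ κ : ℝ} (e : ℕ) (h0 : 0 ≤ θ) (h1 : θ ≤ 1) (hκ : -1 < κ) :
    0 < 1 + θ ^ e * κ := by
  have hp0 : 0 ≤ θ ^ e := pow_nonneg h0 e
  have hp1 : θ ^ e ≤ 1 := pow_le_one₀ h0 h1
  rcases le_or_gt 0 κ with hk | hk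
  · nlinarith [mul_nonneg hp0 hk]
  · nlinarith [mul_nonneg (sub_nonneg.mpr hp1) (neg_nonneg.mpr hk.le)]

/-- Semialgebraicity of a cylinder monomial `c(x)·θ^M/(1+θκ(x))` (token-identical copy of `RungClosure.lean` v9 §3ag,
landing as `…CylLogSplitP27`). -/
private theorem sa_cylTerm {b : ℕ} (M : ℕ) {G : Set (Fin b → ℝ)} {B : Set (Fin (b + 1) → ℝ)}
    (hB : IsSemialgebraic ℚ B) (hBG : B ⊆ {z | (Fin.init z : Fin b → ℝ) ∈ G}) {c κ : (Fin b → ℝ) → ℝ}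
    (hc : IsSemialgebraicFunOn ℚ G c) (hκ : IsSemialgebraicFunOn ℚ G κ)
    (hden : ∀ z ∈ B, 1 + z (Fin.last b) * κ (Fin.init z) ≠ 0) :
    IsSemialgebraicFunOn ℚ B
      (fun z => c (Fin.init z) * (z (Fin.last b) ^ M / (1 + z (Fin.last b) * κ (Fin.init z)))) := by
  have hcI : IsSemialgebraicFunOn ℚ B (fun z => c (Fin.init z)) := hc.comp_init.mono hBG hB
  have hκI : IsSemialgebraicFunOn ℚ B (fun z => κ (Fin.init z)) := hκ.comp_init.mono hBG hB
  have hsI : IsSemialgebraicFunOn ℚ B (fun z => z (Fin.last b)) := Literature.NumberTheory.Transcendental.isSemialgebraicFunOn_apply hB (Fin.last b)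
  have hdenI : IsSemialgebraicFunOn ℚ B (fun z => 1 + z (Fin.last b) * κ (Fin.init z)) :=
    (IsSemialgebraicFunOn.add_holds (isSemialgebraicFunOn_ratCast hB 1)
      (IsSemialgebraicFunOn.mul_holds hsI hκI)).congr fun _ _ => by simp
  exact IsSemialgebraicFunOn.mul_holds hcI
    (IsSemialgebraicFunOn.div (isSemialgebraicFunOn_pow' hB hsI M) hdenI hden)

/-- Semialgebraicity of a cylinder monomial of either kind `c(x)·θ^M/(1+θ^e κ(x))` off the pole. -/
theorem sa_cylTermE {b : ℕ} (M e : ℕ) {G : Set (Fin b → ℝ)} {B : Set (Fin (b + 1) → ℝ)}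
    (hB : IsSemialgebraic ℚ B) (hBG : B ⊆ {z | (Fin.init z : Fin b → ℝ) ∈ G}) {c κ : (Fin b → ℝ) → ℝ}
    (hc : IsSemialgebraicFunOn ℚ G c) (hκ : IsSemialgebraicFunOn ℚ G κ)
    (hden : ∀ z ∈ B, 1 + z (Fin.last b) ^ e * κ (Fin.init z) ≠ 0) :
    IsSemialgebraicFunOn ℚ B
      (fun z => c (Fin.init z) * (z (Fin.last b) ^ M / (1 + z (Fin.last b) ^ e * κ (Fin.init z)))) := by
  have hcI : IsSemialgebraicFunOn ℚ B (fun z => c (Fin.init z)) := hc.comp_init.mono hBG hB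
  have hκI : IsSemialgebraicFunOn ℚ B (fun z => κ (Fin.init z)) := hκ.comp_init.mono hBG hB
  have hsI : IsSemialgebraicFunOn ℚ B (fun z => z (Fin.last b)) :=
    Literature.NumberTheory.Transcendental.isSemialgebraicFunOn_apply hB (Fin.last b)
  have hdenI : IsSemialgebraicFunOn ℚ B (fun z => 1 + z (Fin.last b) ^ e * κ (Fin.init z)) :=
    (IsSemialgebraicFunOn.add_holds (isSemialgebraicFunOn_ratCast hB 1)
      (IsSemialgebraicFunOn.mul_holds (isSemialgebraicFunOn_pow' hB hsI e) hκI)).congr fun _ _ => by simp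
  exact IsSemialgebraicFunOn.mul_holds hcI
    (IsSemialgebraicFunOn.div (isSemialgebraicFunOn_pow' hB hsI M) hdenI hden)

/-- A `θ`-constant integrand `a(x)` is integrable on the closed band `G × [0,1]` when `a ∈ L¹(G)` (token-identical copy
of `RungClosure.lean` v9 §3ag, landing as `…CylLogSplitP27`). -/
private theorem integrableOn_comp_init_band {b : ℕ} {G : Set (Fin b → ℝ)} (hG : IsSemialgebraic ℚ G)
    {a : (Fin b → ℝ) → ℝ} (ha : IsSemialgebraicFunOn ℚ G a) (hai : IntegrableOn a G) :
    IntegrableOn (fun z : Fin (b + 1) → ℝ => a (Fin.init z)) (KZlog.band G (fun _ => 0) (fun _ => 1)) := by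
  have h0sa : IsSemialgebraicFunOn ℚ G (fun _ => (0:ℝ)) :=
    (isSemialgebraicFunOn_ratCast hG 0).congr fun _ _ => by simp
  have h1sa : IsSemialgebraicFunOn ℚ G (fun _ => (1:ℝ)) :=
    (isSemialgebraicFunOn_ratCast hG 1).congr fun _ _ => by simp
  have hband : IsSemialgebraic ℚ (KZlog.band G (fun _ => (0:ℝ)) (fun _ => 1)) :=
    KZlog.isSemialgebraic_band h0sa h1sa
  have hBm : MeasurableSet (KZlog.band G (fun _ => (0:ℝ)) (fun _ => 1)) := hband.measurableSet_holds
  have hsa : IsSemialgebraicFunOn ℚ (KZlog.band G (fun _ => (0:ℝ)) (fun _ => 1)) (fun z => a (Fin.init z)) :=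
    ha.comp_init.mono (fun z hz => hz.1) hband
  refine KZlog.integrableOn_band_of_lintegral_fibre_le hG.measurableSet_holds (a := fun _ => (0:ℝ))
    (b := fun _ => 1) hBm (fun x t => KZlog.snoc_mem_band)
    (KZ.aestronglyMeasurable_of_isSemialgebraicFunOn hsa hBm) (K := a) (fun x _ => ?_) hai
  simp only [Fin.init_snoc, lintegral_const, Measure.restrict_apply_univ, Real.volume_Icc, sub_zero,
    ENNReal.ofReal_one, mul_one, le_refl]

/-! ### §8 THE `n = 0` STRATUM OF `CircleLogStructure` — PROVED FROM THE TREE'S BAKER THEOREM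

`Literature.NumberTheory.Transcendental.baker_decomposition_complex` (Baker 1975, Thm 2.1 — PROVED in the tree, standard axioms):
a vanishing linear form `r + Σ γ_t ℓ_t = 0` in logarithms `ℓ_t` of algebraic numbers with algebraic coefficients has `r = 0` and
`γ` an algebraic combination of RATIONAL exact relations among the `ℓ_t`.  At base dimension `n = 0` all data of
`CircleLogStructure` are real algebraic NUMBERS (`IsSemialgebraicFunOn.isAlgebraic_apply`); with
`ℓ = (log Wᵢ)ᵢ ⊕ (2i·arctan uⱼ)ⱼ` (`exp ℓ` algebraic: `Wᵢ`, resp. `((1−uⱼ²) + 2uⱼ·i)/(1+uⱼ²)`) and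
`γ = (hᵢ)ᵢ ⊕ (−pⱼ/2 · i)ⱼ` the identity `Σ hᵢ log Wᵢ + Σ pⱼ arctan uⱼ = g` is `−g + Σ γ_t ℓ_t = 0`; Baker gives `g = 0`; the REAL
parts of the rational relations are exact multiplicative relations `∏ Wᵢ^{fᵢ} = 1`, the IMAGINARY parts exact angle relations
`Σ f′ⱼ arctan uⱼ = 0` (so `m ≡ 0`), and the coefficient identities are their real / imaginary parts (`q_ρ = h_{ι(ρ)}/D_ρ`,
`q′_ρ = p_{ι(ρ)}/D_ρ`, `D_ρ` = common denominator).  The critic's «Baker COSTUME(cite)» for the constant stratum is thus a THEOREM here;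
the same computation, made uniform in `x` (the relation vectors depend only on the VALUES `Wᵢ(x), uⱼ(x)`), is the constant-data-cell
case of `CircleLogStructureAt 1`, and the `n ≥ 1` moving-data case is the complex twin of the tree's Ax–Schanuel germ engine. -/

/-! ### §9 `CircleLogStructure` ON CONSTANT-DATA CELLS — PROVED IN EVERY BASE DIMENSION (Baker + `ℝ_alg ≺ ℝ` + a projection)

The cells the glue actually meets inside `CircleLogStructureAt 1` on which the Ax–Schanuel (moving-data) engine is silent are those
where all `Wᵢ`, `uⱼ` are CONSTANT.  There the structure theorem is PROVED here (`circleLogStructure_constData`, any `n`):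
* at an ALGEBRAIC point `x ∈ U` all values are algebraic and `baker_point` (= §8's computation) gives `g x = 0` and
  `h(x) ∈ ℝ·π_W(Rel)`, `p(x) ∈ ℝ·π_u(Rel)` for the module `Rel = relMod a v ⊆ ℚ^{k ⊕ l}` of rational relations among
  `(log aᵢ) ⊕ (2i arctan vⱼ)` (which depends only on the constant VALUES `a = W(x₀)`, `v = u(x₀)`);
* `exists_int_proj`: a rational projection `P` onto a subspace `V ⊆ ℚ^k` gives integer vectors `f_r = D·P e_r ∈ V` with
  `D·N = Σ_r N_r f_r` for all `N ∈ V` — so `q_r := h_r/D` works uniformly in `x`, with no choice of basis;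
* `eqOn_of_eq_at_algebraicPoints`: an identity of `ℚ`-sa functions holding at the algebraic points of `U` holds on `U`, because its
  failure set is `ℚ`-semialgebraic and a nonempty `ℚ`-semialgebraic set has an algebraic point (`algebraicPoints` — VERBATIM COPY of
  the tree's PROVED item stmt-KontsevichZagierPeriods-4090 `DefinableMovesAlgebraicPoints.lean`, unbuilt on the farm this session).
What remains of `CircleLogStructureAt 1` after §8–§9 is the MOVING-DATA case (some `Wᵢ` or `uⱼ` non-constant on the cell): the complex
twin of the tree's Ax–Schanuel germ engine (`…LogPrimitiveNLAxSchanuelGerms`), plus the a.e. sa partition into such cells. -/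

/-! #### §9a Algebraic points of `ℚ`-semialgebraic sets (VERBATIM COPY of
`Theorems/DefinableMovesAlgebraicPoints.lean` = item stmt-KontsevichZagierPeriods-4090, PROVED in the tree but `unbuilt` on the farm
this session — DROP THIS COPY when importable). -/

/-! #### §9b Linear algebra: integer generators of a rational subspace by a projection. -/

/-! #### §9c Pointwise Baker at algebraic data. -/

/-! #### §9d The relation module and the constant-data case of `CircleLogStructure` (all base dimensions). -/

/-! ### §10 `CircleLogStructureAt 1 ⟸ CircleLogStructureMoving` — PROVED: the residual transcendence input is the MOVING-DATA case

With §9 (constant-data cells, any `n`) in hand, `CircleLogStructureAt 1` REDUCES to its MOVING-DATA case on open interval cells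
(`circleLogStructureAt_one_of_moving`).  Tools: the tree's cylindrical decomposition over the coefficient field `ℚ`
(`IsSemialgebraic.exists_cylindricalDecomposition_holds`, level 1: cells are points and open intervals — `exists_interval_cells`),
`ℚ`-semialgebraicity of partial derivatives (`IsSemialgebraicFunOn.fderiv_apply_single`), the smooth locus
(`exists_open_smooth_subset`), constancy from a vanishing derivative on a convex cell, and a flattening of two-level a.e. partitions.
The glue of §3–§7 consumes `CircleLogStructure` only at base dimension `1` (refactored: `circleStructure_cells` now takes
`CircleLogStructureAt b`, the chain `cellCloseC_of_cellCloseCS … cylKernelZeroCirclePos_of_CLS_CBR_wild` takes `CircleLogStructureAt 1`),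
so the g13 node SHARPENS to  `CylKernelZeroCirclePos ⟸ CircleLogStructureMoving ∧ CircleBoundaryRigidity ∧ CellCloseCSWild`
(§11 `cylKernelZeroCirclePos_of_moving_CBR_wild`). -/

/-! #### §10a Interval cells of an open `ℚ`-sa subset of `ℝ¹` adapted to finitely many `ℚ`-sa sets (tree CAD, level 1). -/

/-! #### §10b Flattening a two-level a.e. partition. -/

/-! #### §10c Constancy on an interval cell from a vanishing derivative. -/

/-! #### §10d The MOVING-DATA residual and the reduction `CircleLogStructureAt 1 ⟸ (constant cells: §9) + moving cells`. -/

/-! ### §11 THE SHARPENED g13 NODE -/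

/-! ### §12 THE LOG-LINEAR CELLS FALL TO THE TREE — `CircleLogStructureAt 1 ⟸ CircleLogStructureMovingCirc` (PROVED)

The tree PROVES the structure theorem for `ℚ`-semialgebraic LOG-linear identities in every base dimension (route
`LiouvilleUnfolding`, crux `LogPrimitiveNL`, line `logderiv-peeling`: `stub_descent stub_peelingStep stub_constRigidity`, all landed;
composed here BY NAME as `logStructure`).  Hence `CircleLogStructureAt n` holds on every cell where the arctangent coefficients vanish
(`circleLogStructureAt_of_p_eq_zero`, every `n`), and the §10 reduction sharpens: refining the interval cells also by the zero sets of
the `pⱼ`, the residual is `CircleLogStructureMovingCirc` — an identity on an interval cell with a GENUINE arctangent term (some `pⱼ`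
nowhere zero) AND a moving datum (`circleLogStructureAt_one_of_movingCirc`).  Node v3: §13. -/

/-! ### §13 THE g13 NODE, v3 (PROVED glue): the transcendence residual is genuinely circular -/

/-! ### §14 `CircleBoundaryRigidity` SPLIT: structure + a TRANSCENDENCE-FREE circle fold (PROVED glue), node v4

As in the tree (`boundaryRigidity_of_stubs` = descent + cellwise fold), `CircleBoundaryRigidityAt n ⟸ CircleLogStructureAt n ∧
CircleCellwiseFoldAt n` (`circleBoundaryRigidityAt_of_CLS_fold`).  Since the chain consumes `CircleBoundaryRigidityAt 1` only (refactor: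
`r1C_of_circleBoundaryRigidity`, `r1C₂_…`, `tameCloseC` take `CircleBoundaryRigidityAt b`, `cellCloseCSTame_of_circleBoundaryRigidity` and
`cylKernelZeroCirclePos_of_CLS_CBR_wild` take `… 1`) and `CircleLogStructureAt 1 ⟸ CircleLogStructureMovingCirc` (§12), the node becomes
`CylKernelZeroCirclePos ⟸ CircleLogStructureMovingCirc ∧ CircleCellwiseFoldAt 1 ∧ CellCloseCSWild` — ONE transcendence statement (functional,
genuinely circular) and TWO KZ-calculus statements (the exact-relation fold; the wild residual). -/

/-! ### §15 The fold SPLIT: LOG fold (the tree's theorem) + ANGLE fold (the circular residual), node v5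

`CircleCellwiseFoldAt n ⟸ LogCellwiseFoldAt n ∧ AngleCellwiseFoldAt n` (the two band families fold separately).  `LogCellwiseFoldAt n` is
VERBATIM the tree's `stub_cellwiseFold stub_coneDecomposition n` (PROVED; module unbuilt on the farm tonight, so it stays a named hypothesis
here), and the open KZ-calculus content of boundary rigidity is exactly `AngleCellwiseFoldAt 1`: angle addition in families. -/

/-! ### §16 CIRCLE CONSTANT-COEFFICIENT RIGIDITY — PROVED (the bottom of the descent for `CircleLogStructureMovingCirc`)

The tree proves `LogStructure` by a Kolchin–Ostrowski DESCENT (`stub_descent`: differentiate the identity along the cell, peel —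
`stub_peelingStep` — until the coefficients are ALGEBRAIC CONSTANTS) down to `stub_constRigidity` (constant coefficients, MOVING `Wᵢ`:
pointwise Baker at the dense RATIONAL points, where all values are algebraic and the integer structure of the coefficient vector does not
depend on the point).  The same descent is the PLAN for `CircleLogStructureMovingCirc` (the extra terms `pⱼ arctan uⱼ` differentiate to
`pⱼ′ arctan uⱼ + pⱼ uⱼ′/(1+uⱼ²)`, the second summand `ℚ`-sa); its BOTTOM is proved here: `circleConstRigidity` — for constant algebraic
coefficients the log relations and the angle relations DECOUPLE and the angle relations are EXACT (`Σ f′ arctan u ≡ 0`, no `π`). -/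

/-! ### §17 The CONSTANT-COEFFICIENT case of the structure theorem for MOVING data — PROVED (first rung of the descent)

Complementary to §9 (constant DATA `Wᵢ,uⱼ`, moving coefficients): here the COEFFICIENTS `hᵢ,pⱼ` are constant and the data move.  One cell,
exact angle relations, constant algebraic `q, q′` (`isSemialgebraicFunOn_const_of_isAlgebraic`).  E.g. the moving identity
`arctan u + arctan((1−u)/(1+u)) − arctan 1 = 0` on `{−1 < u}` is covered (relation `f′ = (1,1,−1)`, exact). -/

/-! ### §18 Projectively constant coefficients (case (a) of the descent step) — PROVED -/

/-! ### §19 Localisation: the structure conclusion is local for a.e. open sa partitions (every `n`) — PROVED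

The bookkeeping step used at every level of the descent (`DESCENT-blueprint.md`, step 5): if `G ⊆ U` has null complement in `U`, `T` is an
a.e. partition of `G`, and the structure conclusion holds on every `T b`, then it holds on `U` (flatten the two levels of cells). -/

/-! ### §20 The differentiated identity (descent step 3, every dimension) — PROVED -/

/-! ### §21 Elimination of one term by an EXACT relation (descent step 4(b), every `n`) — PROVED

Log version (`∏ W^{f₀} = 1`, `f₀ i₀ ≠ 0`) and angle version (`Σ f′₀ arctan u = 0`, `f′₀ j₀ ≠ 0`): the reduced identity, and the translation of the
structure data of the reduced family back to the original one (append `f₀` with the sa coefficient `h_{i₀}/f₀_{i₀}`, resp. `f′₀`, `m = 0`, `p_{j₀}/f′₀_{j₀}`). -/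

/-! ### §22 Dropping a term whose coefficient vanishes identically (descent step 1, every `n`) — PROVED

Reindex by `Fin.succAbove`; translate the structure data back by extending each relation with exponent `0` at the dropped index (`Fin.insertNth`).
With §21 this makes the term count DROP in the descent (eliminate ⇒ coefficient `≡ 0` ⇒ drop). -/

/-! ### §23 The EXACT structure predicate `CircleStructExactOn` — the invariant of the descent — and the exact twins of §17–§22 (PROVED)

The induction for `CircleLogStructureMovingCirc` / `CircleLogStructureAt 1` must run on this predicate (all angle relations `= 0`): case (b′) of the
descent step eliminates an angle term by a relation RETURNED by the recursive call, which therefore has to be exact.  `circleLogStructure_of_exact`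
converts to the `CircleLogStructure` conclusion at the end (`m ≡ 0`).  The twins: `circleStructExact_constCoeff` (bottom, from §16), `_projConstCoeff`
(case (a)), `_of_cells` (glue), `_elimLog` / `_elimAngle` (case (b)/(b′)), `_dropLog` / `_dropAngle` (term count drops). -/

/-! ### §24 THE DESCENT LOOP — `CircleLogStructureAt 1` PROVED (Kolchin–Ostrowski descent on the number of terms, base dimension 1)

Strong induction on `k + l` for the EXACT predicate `CircleStructExactOn` (§23), over an ARBITRARY `ℚ`-sa base `U ⊆ ℝ¹` (the loop
re-localises at every level).  One round (`exactLevel_of_lower`):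
* §24a localise (`circleStructExact_localise`): smooth locus of the data (null complement, tree) → interval cells of the level-1 CAD
  adapted to the zero sets of the coefficients `hᵢ, pⱼ` → on each cell every coefficient is `≡ 0` or nowhere `0`; glue a.e. (§19/§23);
* all coefficients `≡ 0` ⇒ §18 with `φ = 1`, `c = d = 0`;
* else (`circleStructExact_round`) normalise by a nowhere-zero coefficient `φ` and differentiate (§20): the `φ`-slot of the
  differentiated identity has coefficient `∂(φ/φ) ≡ 0`, so it DROPS (§22) and the induction hypothesis (one term fewer) returns EXACT
  structure data for the differentiated normalised coefficients `∂(hᵢ/φ), ∂(pⱼ/φ)` (`exact_of_zeroLog` / `exact_of_zeroAngle`);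
* (`circleStructExact_of_derivData`) on each cell of those data, refined to interval cells where every `∂(hᵢ/φ), ∂(pⱼ/φ)` is `≡ 0` or
  nowhere `0`: all `≡ 0` ⇒ `hᵢ = φ·cᵢ`, `pⱼ = φ·dⱼ` (convexity) ⇒ §18; some `∂(h_{i₁}/φ)` nowhere `0` ⇒ one of the returned EXACT
  multiplicative relations `f` has `f i₁ ≠ 0` ⇒ eliminate the `i₁`-term (§21) ⇒ its coefficient is `≡ 0` ⇒ drop (§22) ⇒ induction
  hypothesis ⇒ translate back (§23 twins); some `∂(p_{j₁}/φ)` nowhere `0` ⇒ the twin with an EXACT angle relation.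
`exactLevel_all` is the loop; `circleLogStructureAt_one : CircleLogStructureAt 1` and
`circleLogStructureMovingCirc_holds : CircleLogStructureMovingCirc` follow (§23 `circleLogStructure_of_exact`). -/

/-! #### §24a The level statement; the empty base; localisation to adapted interval cells. -/

/-- **The descent level `(k, l)`**: EXACT structure (§23) for every `ℚ`-sa identity with `k` logarithmic and `l` arctangent terms over
an arbitrary `ℚ`-sa base `U ⊆ ℝ¹`. -/
def ExactLevel (k l : ℕ) : Prop :=
  ∀ (U : Set (Fin 1 → ℝ)) (h W : Fin k → (Fin 1 → ℝ) → ℝ) (p u : Fin l → (Fin 1 → ℝ) → ℝ) (g : (Fin 1 → ℝ) → ℝ),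
    IsSemialgebraic ℚ U → (∀ i, IsSemialgebraicFunOn ℚ U (h i)) →
    (∀ i, IsSemialgebraicFunOn ℚ U (W i)) → (∀ i, ∀ x ∈ U, 0 < W i x) →
    (∀ j, IsSemialgebraicFunOn ℚ U (p j)) → (∀ j, IsSemialgebraicFunOn ℚ U (u j)) →
    IsSemialgebraicFunOn ℚ U g →
    (∀ x ∈ U, ∑ i, h i x * Real.log (W i x) + ∑ j, p j x * Real.arctan (u j x) = g x) →
    CircleStructExactOn k l U h W p u g

/-- Exact structure over the empty base (no cells). -/
theorem circleStructExact_empty {n k l : ℕ} {h W : Fin k → (Fin n → ℝ) → ℝ} {p u : Fin l → (Fin n → ℝ) → ℝ}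
    {g : (Fin n → ℝ) → ℝ} : CircleStructExactOn k l (∅ : Set (Fin n → ℝ)) h W p u g := by
  refine ⟨0, Fin.elim0, fun c => c.elim0, fun c => c.elim0, ?_, fun c => c.elim0⟩
  simp

open scoped ContDiff in
/-- **Localisation to adapted interval cells** (descent bookkeeping, base dimension 1): to prove EXACT structure over a `ℚ`-sa
`U ⊆ ℝ¹` it suffices to prove it over every open convex `ℚ`-sa cell `T ⊆ U` on which finitely many given `ℚ`-sa functions `v j` are
smooth and finitely many given `ℚ`-sa functions `F t` are each `≡ 0` or nowhere `0` (smooth locus, tree `exists_open_smooth_subset`;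
interval cells of the level-1 CAD adapted to the zero sets, §10a; null complements; glue by §23 `circleStructExact_of_cells`). -/
theorem circleStructExact_localise {k l m m' : ℕ} {U : Set (Fin 1 → ℝ)} (hU : IsSemialgebraic ℚ U)
    {h W : Fin k → (Fin 1 → ℝ) → ℝ} {p u : Fin l → (Fin 1 → ℝ) → ℝ} {g : (Fin 1 → ℝ) → ℝ}
    (v : Fin m' → (Fin 1 → ℝ) → ℝ) (hv : ∀ j, IsSemialgebraicFunOn ℚ U (v j))
    (F : Fin m → (Fin 1 → ℝ) → ℝ) (hF : ∀ t, IsSemialgebraicFunOn ℚ U (F t))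
    (hcell : ∀ T : Set (Fin 1 → ℝ), T ⊆ U → IsSemialgebraic ℚ T → IsOpen T → Convex ℝ T →
      (∀ j, ContDiffOn ℝ ∞ (v j) T) → (∀ t, (∀ x ∈ T, F t x = 0) ∨ (∀ x ∈ T, F t x ≠ 0)) →
      CircleStructExactOn k l T h W p u g) :
    CircleStructExactOn k l U h W p u g := by
  classical
  obtain ⟨G, hGU, hGo, hG, hvsm, hUG⟩ := exists_open_smooth_subset hU v hv
  set Z : Fin m → Set (Fin 1 → ℝ) := fun t => {x | x ∈ G ∧ F t x = 0} with hZ_def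
  have hZ : ∀ t, IsSemialgebraic ℚ (Z t) := fun t => ((hF t).mono hGU hG).isSemialgebraic_sep_eq_zero
  obtain ⟨B, T, hT, hTd, hTn, hTZ⟩ := exists_interval_cells hG Z hZ
  refine circleStructExact_of_cells hGU hUG T (fun b => (hT b).2.2.2) hTd hTn fun b => ?_
  obtain ⟨hTsa, hTo, hTc, hTG⟩ := hT b
  refine hcell (T b) (hTG.trans hGU) hTsa hTo hTc (fun j => (hvsm j).mono hTG) fun t => ?_
  rcases hTZ b t with hsub | hdis
  · refine Or.inl fun x hx => ?_
    have h1 := hsub hx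
    simp only [hZ_def, Set.mem_setOf_eq] at h1
    exact h1.2
  · refine Or.inr fun x hx h0 => Set.disjoint_left.mp hdis hx ?_
    simp only [hZ_def, Set.mem_setOf_eq]
    exact ⟨hTG hx, h0⟩

/-! #### §24b Calculus on a prepared cell: the right-hand side is differentiable; quotients; the `ℚ`-sa right-hand side of §20. -/

/-- The right-hand side `g` of the identity is differentiable on an open set where the data are (it agrees with the left-hand side). -/
theorem circle_identity_differentiableAt_rhs {n k l : ℕ} {U : Set (Fin n → ℝ)} (hUo : IsOpen U)
    {h W : Fin k → (Fin n → ℝ) → ℝ} {p u : Fin l → (Fin n → ℝ) → ℝ} {g : (Fin n → ℝ) → ℝ}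
    (hhd : ∀ i, ∀ x ∈ U, DifferentiableAt ℝ (h i) x) (hWd : ∀ i, ∀ x ∈ U, DifferentiableAt ℝ (W i) x)
    (hW0 : ∀ i, ∀ x ∈ U, 0 < W i x)
    (hpd : ∀ j, ∀ x ∈ U, DifferentiableAt ℝ (p j) x) (hud : ∀ j, ∀ x ∈ U, DifferentiableAt ℝ (u j) x)
    (hid : ∀ x ∈ U, ∑ i, h i x * Real.log (W i x) + ∑ j, p j x * Real.arctan (u j x) = g x) :
    ∀ x ∈ U, DifferentiableAt ℝ g x := by
  intro x hx
  have hF : DifferentiableAt ℝ (fun y => ∑ i, h i y * Real.log (W i y) + ∑ j, p j y * Real.arctan (u j y)) x :=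
    (DifferentiableAt.fun_sum fun i _ => (hhd i x hx).fun_mul ((hWd i x hx).log (hW0 i x hx).ne')).fun_add
      (DifferentiableAt.fun_sum fun j _ => (hpd j x hx).fun_mul (hud j x hx).arctan)
  refine hF.congr_of_eventuallyEq ?_
  filter_upwards [hUo.mem_nhds hx] with y hy
  exact (hid y hy).symm

/-- Quotient rule, differentiability only. -/
theorem differentiableAt_div_of {n : ℕ} {f φ : (Fin n → ℝ) → ℝ} {x : Fin n → ℝ} (hf : DifferentiableAt ℝ f x)
    (hφ : DifferentiableAt ℝ φ x) (h0 : φ x ≠ 0) : DifferentiableAt ℝ (fun y => f y / φ y) x := by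
  have h1 : DifferentiableAt ℝ (fun y => f y * (φ y)⁻¹) x := hf.fun_mul (hφ.fun_inv h0)
  simpa only [div_eq_mul_inv] using h1

end G13
end Summit.KontsevichZagierPeriods.RootDecompRelativeModAbsolute.Rung30571.RegularisedLogLayer.CylLog.Leaf
end
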